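import Summits.HodgeConjecture.HodgeConjecture.Theorems.F0P3cStCharTSUniqPar          -- ★ p851567 (LH6-p02 g5) «UNIQ-PAR ⟸ KEYS-RED★»: `conjInvChar_quadChar_mul_half`; brings ★ Ps2Kind3 (`isConstituentOf_iff_of_eq`, K1w `isConstituentOf_iff_weyl`), the PAIR currency
import Summits.HodgeConjecture.HodgeConjecture.Theorems.F0P2oStubDictTorusChar         -- ★ (F0P2-p02) `exists_quotConj_eq_of_nonsplit` — local Hilbert 90: `a ↦ a/ā : L_v^× → E¹_v` is onto at a non-split place
import Summits.HodgeConjecture.HodgeConjecture.Theorems.F0P3cStCharTSTorusRay          -- ★ (LH6-p01 g2) `secondCountableTopology_units_localRing`, `locallyCompactSpace_normOneUnits`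
import Mathlib.Topology.Algebra.Group.OpenMapping                                      -- Mathlib: `MonoidHom.isOpenMap_of_sigmaCompact` (open mapping theorem for σ-compact groups)
import HarnessLib

/-!
# F0 · P3c · line LH6 «StCharTS» — datum road, stage B of «RED-JH ⟸ KEYS-RED»: «QUAD-REPARAM★» — EVERY KEYS CASE-(2) PARAMETER `(η‖·‖^{±1/2}, χ₂)`, `η|F* = ω_{E/F}`,
# IS ONE OF THE DATUM'S `χ_ξ = cmXiTorusChar μ_v η₁ χ₂` AT THE FIXED `ω`-TYPE `μ_v`, UP TO THE WEYL REFLECTION  [Rogawski1990 §12.2 (2) pp. 173–174; §12.1 p. 172]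

Cell `pub/hodgecm-mathlib`, crux H413 = `stmt-HodgeConjecture-24833` (`--supports` lane, helper), route HCCMUnconditional; seat LH6-p04 (g6), stage-B brick of the
assembly «RED-JH ⟸ KEYS-RED» (named to this seat by LH6-p03 (g4) 2026-09-02T13:10:59Z; map owner LH6-p01 (g4) 13:16:28Z).  THEOREMS ONLY, sorry-free, no
definition ∕ instance ∕ notation ∕ named fact.  HONEST LABEL: HC_CM is proved only modulo the 7 printed citations (2 remaining: hLiu418 = stmt-HodgeConjecture-24832,
h413 = stmt-HodgeConjecture-24833) until rung 0 closes; count-neutral (closes no organ; no leaf edition implied).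

WHY.  Keys' reducibility theorem in the tree's hypothesis form `hKeysRed` (★ `F0P3cStCharTSUniqPar` :297–305, [Rogawski1990 §12.2 p. 173 ll. 8–12; Keys1984 §7]) names
case (2) by an ARBITRARY `ω`-type character `η` of `L_v^×` («`χ₁ = η‖·‖^{1/2}` or `η‖·‖^{-1/2}`, `η|F* = ω`»), whereas the datum's Keys labels `pi2 ξ′ ∕ piN ξ′` (★ S6∕S6b∕XI-SURJ,
`KeysCaseTwoLabels L v μ_v η₁ η₂ …`) are indexed by the character `χ_ξ = cmXiTorusChar L v μ_v η₁ η₂ = (η̃₁ · μ_v · ‖·‖^{1/2}, η₂)` at the FIXED `ω`-type `μ_v`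
(the local component of the Hecke character `μ` of §4.8).  Print (§12.2 p. 174): «`η′(a/ā) = ημ⁻¹(a)` … Then `ξ` determines `χ`» — i.e. `η = η̃′·μ` with
`η′ ∈ Hom(E¹, ℂ*)`, because `ημ⁻¹` is trivial on `F*` (two `ω`-type characters AGREE on `F*`: both are `±1`-valued there, `= 1` exactly on the norms) and
`E*∕F* ≅ E¹` by `a ↦ a/ā` (Hilbert 90).  This file supplies that factorisation, CONTINUOUSLY, and the resulting constituent transport.

* §1 `exists_normOneChar_comp_quotConj_eq` — at a NON-SPLIT `v`: a continuous character `θ` of `L_v^×` trivial on the `σ`-fixed units is `η₁ ∘ (a ↦ a/ā)` for a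
  continuous character `η₁` of `E¹_v` (★ local Hilbert 90 `exists_quotConj_eq_of_nonsplit` for surjectivity; Mathlib's open mapping theorem
  `MonoidHom.isOpenMap_of_sigmaCompact` — `L_v^×` is σ-compact, `E¹_v` locally compact Hausdorff — makes `a ↦ a/ā` a quotient map, whence continuity of `η₁`).
* §2 `quadChar_apply_eq_of_fixed` — two `ω`-type characters (★ `IsQuadraticCharExtension`) agree on the `σ`-fixed units (`η(a)² = η(a·a) = η(ā a) = 1`, and
  `η(a) = 1 ↔ a` is a norm `↔ μ(a) = 1`).
* §3 `exists_cmXiTorusChar_eq_of_quadChar` — `∃ η₁` continuous with `cmXiTorusChar L v μ_v η₁ χ₂ = cmTorusCharPair L v (η · ‖·‖^{1/2}) χ₂` (★ `cmXiTorusChar_eq_cmTorusCharPair`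
  is `rfl`); `isConstituentOf_quadChar_iff` ∕ `isConstituentOf_quadCharInv_iff` — the constituents of `i_G(η‖·‖^{1/2}, χ₂)` and of `i_G(η‖·‖^{-1/2}, χ₂)` are those of
  `i_G(χ_ξ)` at `(μ_v, η₁, χ₂)` (★ `isConstituentOf_iff_of_eq`; the `‖·‖^{-1/2}` alternative through ★ K1w `isConstituentOf_iff_weyl` + ★ `conjInvChar_quadChar_mul_half`);
  `exists_keysParam_of_quadChar` packages the three for the RED-JH assembly.

## References
* [Rogawski1990] J. D. Rogawski, *Automorphic Representations of Unitary Groups in Three Variables*, Ann. of Math. Stud. 123 (1990): §12.1 p. 172 (`χ̃(a) = χ(a/ā)`);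
  §12.2 (2) pp. 173–174 («`η′(a/ā) = ημ⁻¹(a)` … `ξ` determines `χ`»; «`i_G(χ)` and `i_G(wχ)` have the same sets of constituents»); §4.8 p. 51 (`μ|F* = ω`).
* [Keys1984] D. Keys, *Principal series representations of special unitary groups over local fields*, Compositio Math. 51 (1984), §7 Thm. p. 126.
-/

set_option autoImplicit false
-- the mandated namespace has the single-problem summit's repeated segment (`HodgeConjecture.HodgeConjecture`)
set_option linter.dupNamespace false

noncomputable section

open NumberField IsDedekindDomain Topology
open scoped Matrix

open Literature.NumberTheory.Rogawski1990 Literature.NumberTheory.Automorphic Literature.NumberTheory.Automorphic.UnitaryGroup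

namespace Summit.HodgeConjecture.HodgeConjecture.Cruxes.H413.F0P3cStCharTSQuadReparam

variable (L : Type) [Field L] [NumberField L] [IsCMField L] (v : HeightOneSpectrum (𝓞 ↥(maximalRealSubfield L)))

/-! ## §1 Characters of `L_v^×` trivial on `F_v^×` factor CONTINUOUSLY through `a ↦ a/ā` (local Hilbert 90 + open mapping theorem) -/

/-- **`a ↦ a/ā : L_v^× → E¹_v` is an OPEN QUOTIENT MAP at a non-split `v`**: it is a continuous (★ `continuous_quotConj`) surjective (local Hilbert 90, ★
`exists_quotConj_eq_of_nonsplit`) homomorphism from the σ-compact group `L_v^×` (second countable ★ + locally compact) onto the locally compact Hausdorff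
group `E¹_v` (★ `locallyCompactSpace_normOneUnits`), hence open by Mathlib's open mapping theorem `MonoidHom.isOpenMap_of_sigmaCompact`.
[cite: Rogawski1990, §12.1 p. 172] -/
theorem isQuotientMap_quotConj (hns : ∀ w : PlacesOver L v, IsCMField.complexConj L • w.1 = w.1) :
    IsQuotientMap (quotConj (conjLocal L (IsCMField.complexConj L) v) (conjLocal_conjLocal_cm L v)) := by
  haveI := F0P3cStCharTSTorusRay.secondCountableTopology_units_localRing L v
  haveI := F0P3cStCharTSTorusRay.locallyCompactSpace_normOneUnits L v
  have hsurj : Function.Surjective (quotConj (conjLocal L (IsCMField.complexConj L) v) (conjLocal_conjLocal_cm L v)) := fun β =>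
    F0P2oStubDictTorusChar.exists_quotConj_eq_of_nonsplit L v hns β
  have hcont : Continuous (quotConj (conjLocal L (IsCMField.complexConj L) v) (conjLocal_conjLocal_cm L v)) :=
    continuous_quotConj _ (conjLocal_conjLocal_cm L v) (continuous_conjLocal L (IsCMField.complexConj L) v)
  exact (MonoidHom.isOpenMap_of_sigmaCompact _ hsurj hcont).isQuotientMap hcont hsurj

/-- **Local Hilbert 90 for characters**: at a NON-SPLIT `v`, a continuous character `θ` of `L_v^×` which is trivial on the `σ`-fixed units (`F_v^×`) is
`θ = η₁ ∘ (a ↦ a/ā)` for a (unique) CONTINUOUS character `η₁` of `E¹_v` — print's «`η′(a/ā) = ημ⁻¹(a)`» [§12.2 p. 174] ∕ «`χ̃(a) = χ(a/ā)`» [§12.1 p. 172].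
Kernel: `a/ā = 1 ↔ ā = a`; lift by Mathlib `MonoidHom.liftOfSurjective`; continuity through the quotient map of `isQuotientMap_quotConj`. [cite: Rogawski1990, §12.2 p. 174; §12.1 p. 172] -/
theorem exists_normOneChar_comp_quotConj_eq (hns : ∀ w : PlacesOver L v, IsCMField.complexConj L • w.1 = w.1)
    (θ : (LocalRing L v)ˣ →* ℂˣ) (hθc : Continuous fun x => ((θ x : ℂˣ) : ℂ))
    (hfix : ∀ a : (LocalRing L v)ˣ, (conjLocal L (IsCMField.complexConj L) v) (a : LocalRing L v) = a → θ a = 1) :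
    ∃ η₁ : ↥(normOneUnits (conjLocal L (IsCMField.complexConj L) v)) →* ℂˣ,
      Continuous (fun x => ((η₁ x : ℂˣ) : ℂ)) ∧ η₁.comp (quotConj (conjLocal L (IsCMField.complexConj L) v) (conjLocal_conjLocal_cm L v)) = θ := by
  set q := quotConj (conjLocal L (IsCMField.complexConj L) v) (conjLocal_conjLocal_cm L v) with hq
  have hsurj : Function.Surjective q := fun β => F0P2oStubDictTorusChar.exists_quotConj_eq_of_nonsplit L v hns β
  -- `ker (a ↦ a/ā) ≤ ker θ`: `a · σ(a)⁻¹ = 1` forces `σ a = a`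
  have hker : q.ker ≤ θ.ker := by
    intro a ha
    rw [MonoidHom.mem_ker] at ha ⊢
    have h1 : ((q a : ↥(normOneUnits (conjLocal L (IsCMField.complexConj L) v))) : (LocalRing L v)ˣ) = 1 := by
      rw [ha, OneMemClass.coe_one]
    rw [hq, coe_quotConj, mul_inv_eq_one] at h1
    refine hfix a ?_
    have h2 := congrArg (fun u : (LocalRing L v)ˣ => (u : LocalRing L v)) h1
    simp only [Units.coe_map, MonoidHom.coe_coe] at h2
    exact h2.symm
  refine ⟨q.liftOfSurjective hsurj ⟨θ, hker⟩, ?_, q.liftOfRightInverse_comp _ _ ⟨θ, hker⟩⟩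
  -- continuity: `q` is a quotient map and `η₁ ∘ q = θ` is continuous
  have hcomp : (fun x : ↥(normOneUnits (conjLocal L (IsCMField.complexConj L) v)) => (((q.liftOfSurjective hsurj ⟨θ, hker⟩) x : ℂˣ) : ℂ)) ∘ q =
      fun a => ((θ a : ℂˣ) : ℂ) := by
    funext a
    simp only [Function.comp_apply]
    rw [← MonoidHom.comp_apply, q.liftOfRightInverse_comp _ _ ⟨θ, hker⟩]
  rw [(isQuotientMap_quotConj L v hns).continuous_iff, hcomp]
  exact hθc

/-! ## §2 Two `ω`-type characters agree on `F_v^×` -/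

omit [IsCMField L] in
/-- **Two characters of `ω`-type agree on the `σ`-fixed units** (★ `IsQuadraticCharExtension σ η`: on `σ`-fixed `a`, `η a = 1 ↔ a = ȳy`): for `σ a = a`, `a·a = ā a` is a
norm, so `η(a)² = 1`, i.e. `η a = ±1`, with the sign decided by whether `a` is a norm — the same rule for `μ`. (Generic `σ`.) [cite: Rogawski1990, §4.8 p. 51; §12.2 (2) p. 173] -/
theorem quadChar_apply_eq_of_fixed {R : Type*} [CommRing R] (σ : R →+* R) (η μ : Rˣ →* ℂˣ)
    (hη : IsQuadraticCharExtension σ η) (hμ : IsQuadraticCharExtension σ μ) (a : Rˣ) (ha : σ (a : R) = a) : η a = μ a := by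
  by_cases hn : ∃ y : Rˣ, σ (y : R) * y = a
  · rw [(hη a ha).2 hn, (hμ a ha).2 hn]
  · -- not a norm: both values are square roots of `1` different from `1`, i.e. `-1`
    have haa : σ ((a * a : Rˣ) : R) = (a * a : Rˣ) := by rw [Units.val_mul, map_mul, ha]
    have hsq : ∃ y : Rˣ, σ (y : R) * y = (a * a : Rˣ) := ⟨a, by rw [ha, Units.val_mul]⟩
    have hval : ∀ ν : Rˣ →* ℂˣ, IsQuadraticCharExtension σ ν → ((ν a : ℂˣ) : ℂ) = -1 := by
      intro ν hν
      have h2 : ((ν a : ℂˣ) : ℂ) * ((ν a : ℂˣ) : ℂ) = 1 := by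
        rw [← Units.val_mul, ← map_mul, (hν _ haa).2 hsq, Units.val_one]
      rcases mul_self_eq_one_iff.1 h2 with h | h
      · exact absurd ((hν a ha).1 (Units.val_eq_one.1 h)) hn
      · exact h
    exact Units.val_injective ((hval η hη).trans (hval μ hμ).symm)

omit [IsCMField L] in
/-- **`η · μ⁻¹` is trivial on the `σ`-fixed units** for two `ω`-type characters `η`, `μ`. [cite: Rogawski1990, §12.2 (2) p. 174] -/
theorem quadChar_mul_inv_apply_eq_one_of_fixed {R : Type*} [CommRing R] (σ : R →+* R) (η μ : Rˣ →* ℂˣ)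
    (hη : IsQuadraticCharExtension σ η) (hμ : IsQuadraticCharExtension σ μ) (a : Rˣ) (ha : σ (a : R) = a) : (η * μ⁻¹) a = 1 := by
  rw [MonoidHom.mul_apply, MonoidHom.inv_apply, quadChar_apply_eq_of_fixed σ η μ hη hμ a ha, mul_inv_cancel]

/-! ## §3 Every case-(2) parameter is a `χ_ξ` at the fixed `μ_v`; constituent transport -/

/-- **«QUAD-REPARAM★»**: at a NON-SPLIT `v`, for the fixed continuous `ω`-type `μ_v` and ANY continuous `ω`-type `η`, there is a continuous character `η₁` of `E¹_v`
with `χ_ξ(μ_v, η₁, χ₂) = cmXiTorusChar L v μ_v η₁ χ₂ = (η‖·‖^{1/2}, χ₂) = cmTorusCharPair L v (η · halfModulusChar) χ₂` — print's «`η′(a/ā) = ημ⁻¹(a)` … `ξ` determines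
`χ`» (§1 at `θ = ημ_v⁻¹`, trivial on `F*` by §2; ★ `cmXiTorusChar_eq_cmTorusCharPair` is `rfl`). [cite: Rogawski1990, §12.2 (2) p. 174; §12.1 pp. 171–172] -/
theorem exists_cmXiTorusChar_eq_of_quadChar (hns : ∀ w : PlacesOver L v, IsCMField.complexConj L • w.1 = w.1)
    (μv : (LocalRing L v)ˣ →* ℂˣ) (hμv : IsQuadraticCharExtension (conjLocal L (IsCMField.complexConj L) v) μv) (hμvc : Continuous fun x => ((μv x : ℂˣ) : ℂ))
    (η : (LocalRing L v)ˣ →* ℂˣ) (hη : IsQuadraticCharExtension (conjLocal L (IsCMField.complexConj L) v) η) (hηc : Continuous fun x => ((η x : ℂˣ) : ℂ))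
    (χ₂ : ↥(normOneUnits (conjLocal L (IsCMField.complexConj L) v)) →* ℂˣ) :
    ∃ η₁ : ↥(normOneUnits (conjLocal L (IsCMField.complexConj L) v)) →* ℂˣ, Continuous (fun x => ((η₁ x : ℂˣ) : ℂ)) ∧
      cmXiTorusChar L v μv η₁ χ₂ = cmTorusCharPair L v (η * halfModulusChar (LocalRing L v)) χ₂ := by
  have hθc : Continuous fun x => (((η * μv⁻¹) x : ℂˣ) : ℂ) := by
    have : (fun x => (((η * μv⁻¹) x : ℂˣ) : ℂ)) = fun x => ((η x : ℂˣ) : ℂ) * (((μv x : ℂˣ) : ℂ))⁻¹ := by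
      funext x
      rw [MonoidHom.mul_apply, MonoidHom.inv_apply, Units.val_mul, Units.val_inv_eq_inv_val]
    rw [this]
    exact hηc.mul (hμvc.inv₀ fun x => Units.ne_zero _)
  obtain ⟨η₁, hη₁c, hcomp⟩ := exists_normOneChar_comp_quotConj_eq L v hns (η * μv⁻¹) hθc
    (fun a ha => quadChar_mul_inv_apply_eq_one_of_fixed _ η μv hη hμv a ha)
  refine ⟨η₁, hη₁c, ?_⟩
  have hημ : η * μv⁻¹ * μv = η := MonoidHom.ext fun x => by
    rw [MonoidHom.mul_apply, MonoidHom.mul_apply, MonoidHom.inv_apply, inv_mul_cancel_right]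
  rw [cmXiTorusChar_eq_cmTorusCharPair, hcomp, hημ]

set_option synthInstance.maxHeartbeats 400000 in
set_option maxHeartbeats 4000000 in
-- statement-heavy: three `IsConstituentOf (cmPrincipalSeries …)` shapes (the `Gqs`↔carrier defeq class of ★ PS2-KIND3 §0 ∕ ★ UNIQ-PAR §3)
/-- **Packaged for the RED-JH assembly**: at a NON-SPLIT `v`, fixed continuous `ω`-type `μ_v`, any continuous `ω`-type `η` and any `χ₂`, there is a continuous `η₁` on `E¹_v`
such that the constituents of `i_G(η‖·‖^{1/2}, χ₂)` AND of `i_G(η‖·‖^{-1/2}, χ₂)` are exactly those of `i_G(χ_ξ)` at `(μ_v, η₁, χ₂)` (`exists_cmXiTorusChar_eq_of_quadChar` + ★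
`isConstituentOf_iff_of_eq`; the `‖·‖^{-1/2}` alternative is the Weyl conjugate, ★ `conjInvChar_quadChar_mul_half` + ★ K1w `isConstituentOf_iff_weyl`: «`i_G(χ)` and `i_G(wχ)`
have the same sets of constituents»). [cite: Rogawski1990, §12.2 (2) pp. 173–174] [cite: Keys1984, §7 Thm. p. 126] -/
theorem exists_keysParam_of_quadChar (hns : ∀ w : PlacesOver L v, IsCMField.complexConj L • w.1 = w.1)
    (μv : (LocalRing L v)ˣ →* ℂˣ) (hμv : IsQuadraticCharExtension (conjLocal L (IsCMField.complexConj L) v) μv) (hμvc : Continuous fun x => ((μv x : ℂˣ) : ℂ))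
    (η : (LocalRing L v)ˣ →* ℂˣ) (hη : IsQuadraticCharExtension (conjLocal L (IsCMField.complexConj L) v) η) (hηc : Continuous fun x => ((η x : ℂˣ) : ℂ))
    (χ₂ : ↥(normOneUnits (conjLocal L (IsCMField.complexConj L) v)) →* ℂˣ) :
    ∃ η₁ : ↥(normOneUnits (conjLocal L (IsCMField.complexConj L) v)) →* ℂˣ, Continuous (fun x => ((η₁ x : ℂˣ) : ℂ)) ∧
      (∀ c : IrrClass (Gqs L v),
        c.IsConstituentOf (cmPrincipalSeries L 3 v (cmTorusCharPair L v (η * halfModulusChar (LocalRing L v)) χ₂)) ↔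
          c.IsConstituentOf (cmPrincipalSeries L 3 v (cmXiTorusChar L v μv η₁ χ₂))) ∧
      (∀ c : IrrClass (Gqs L v),
        c.IsConstituentOf (cmPrincipalSeries L 3 v (cmTorusCharPair L v (η * (halfModulusChar (LocalRing L v))⁻¹) χ₂)) ↔
          c.IsConstituentOf (cmPrincipalSeries L 3 v (cmXiTorusChar L v μv η₁ χ₂))) := by
  obtain ⟨η₁, hη₁c, hξ⟩ := exists_cmXiTorusChar_eq_of_quadChar L v hns μv hμv hμvc η hη hηc χ₂
  refine ⟨η₁, hη₁c, fun c => (F0P3cStCharTSPs2Kind3.isConstituentOf_iff_of_eq L v hξ c).symm, fun c => ?_⟩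
  -- `(η‖·‖^{-1/2}, χ₂) = w(η‖·‖^{1/2}, χ₂)`
  have hw : cmTorusCharPair L v (η * (halfModulusChar (LocalRing L v))⁻¹) χ₂ =
      cmTorusCharPair L v (conjInvChar (conjLocal L (IsCMField.complexConj L) v) (η * halfModulusChar (LocalRing L v))) χ₂ := by
    rw [F0P3cStCharTSUniqPar.conjInvChar_quadChar_mul_half L v η hη]
  rw [F0P3cStCharTSPs2Kind3.isConstituentOf_iff_of_eq L v hw c, ← F0P3cStCharTSPs2Kind3.isConstituentOf_iff_weyl L v hns, ← hξ]

end Summit.HodgeConjecture.HodgeConjecture.Cruxes.H413.F0P3cStCharTSQuadReparam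

end
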